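import Literature.Analysis.FluidPDE.PassiveVectorUniqueness
import Summits.AnomalousDissipation.AnomalousDissipation.Theorems.SolenoidalFractalHomogenisationPermissibleFractalCarrierTime
import HarnessLib

/-!
# Registered stub `stub_cellUnique` of crux K2R `RealisedQuasiStaticCellLaw` (line `floquet-bloch`)
(route `AnomalousDissipation/SolenoidalFractalHomogenisation`, crux item stmt-AnomalousDissipation-20446; planner
ad-ideate-p1 g14, skeleton `HOME/ad-ideate-p1/r13/K2R_floquet_bloch.lean`, stub named in writing 2026-08-27T09:14:46Z /
10:08:43Z; seat ad-ideate-lit g15, cell ad-ideate)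

**A0 weak uniqueness around lattice-word cells.** For every lattice word `W'`, cell number `n`, viscosity `κ > 0`,
horizon `T` and datum `w₀`, two weak solutions (`Torus.IsWeakPassiveVectorOn 0 T κ (W'.cell n) w₀ ·`, the tree's
`L^∞_t L²_x` distributional class, no `L²_t H¹_x` built in) coincide for a.e. `t ∈ (0,T)`.

Proof: the cell carrier `(t, x) ↦ (1/n) • B(t, n • x)` is jointly continuous (the replayed trapezoid envelopes are
continuous in time because they vanish at both ends of the period, `continuous_trapezoid_fract`; the layers are smooth in
space) and bounded by `k/(2π)` (`norm_carrier_nsmul_le`), hence its space–time lift is in `L^∞((0,T) × T³)`; the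
Literature theorem `IsWeakPassiveVectorOn.ae_eq_of_memLp_top` (uniqueness of weak passive-vector solutions with bounded
carrier, any coupling `A`, by the modewise energy method and Grönwall — `PassiveVectorUniqueness`) applies with `A = 0`.
-/

set_option linter.dupNamespace false

noncomputable section

namespace Summit.AnomalousDissipation.AnomalousDissipation.Theorems.SolenoidalFractalHomogenisation.RealisedQuasiStaticCellLaw

open Set Filter Topology MeasureTheory Function
open scoped InnerProductSpace ENNReal NNReal
open Literature.Analysis Literature.Analysis.FunctionSpaces Literature.Analysis.FunctionSpaces.Torus
open Literature.Analysis.FluidPDE Literature.Analysis.FluidPDE.LatticeShear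
open Summit.AnomalousDissipation.AnomalousDissipation.Theorems.SolenoidalFractalHomogenisation.PermissibleCarrier

variable {k : ℕ}

/-- The cell carrier `(t, x) ↦ (1/n) • B(t, n • x)` of a lattice word is jointly continuous on `ℝ × T³`. [folklore] -/
theorem continuous_uncurry_cell (W : LatticeWord k) (n : ℕ) : Continuous (uncurry (W.cell n)) := by
  have e : uncurry (W.cell n) = fun p : ℝ × UnitAddTorus (Fin 3) => (1 / (n : ℝ)) • ∑ j,
      LatticeWord.trapezoid (W.start j) (W.phase j).τ W.ramp (Int.fract (p.1 / W.period) * W.period) •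
        (W.phase j).layer (n • p.2) := by
    funext ⟨t, x⟩
    simp only [uncurry_apply_pair, LatticeWord.cell, carrier_nsmul_apply]
  rw [e]
  have hsum : Continuous fun p : ℝ × UnitAddTorus (Fin 3) => ∑ j,
      LatticeWord.trapezoid (W.start j) (W.phase j).τ W.ramp (Int.fract (p.1 / W.period) * W.period) •
        (W.phase j).layer (n • p.2) := by
    refine continuous_finsetSum _ fun j _ => ?_
    have ht : Continuous fun t : ℝ => LatticeWord.trapezoid (W.start j) (W.phase j).τ W.ramp
        (Int.fract (t / W.period) * W.period) := by
      simpa only [one_mul] using continuous_trapezoid_fract W j 1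
    exact (ht.comp continuous_fst).smul ((isSmooth_layer_nsmul (W.phase j) n).continuous.comp continuous_snd)
  exact hsum.const_smul (1 / (n : ℝ))

/-- The cell carrier is bounded: `‖(W.cell n) t x‖ ≤ k/(2π)`. [folklore] -/
theorem norm_cell_le (W : LatticeWord k) (n : ℕ) (t : ℝ) (x : UnitAddTorus (Fin 3)) :
    ‖W.cell n t x‖ ≤ k / (2 * Real.pi) := by
  rw [LatticeWord.cell, norm_smul]
  have h1 : ‖(1 / (n : ℝ))‖ ≤ 1 := by
    rw [Real.norm_eq_abs, abs_of_nonneg (by positivity)]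
    rcases Nat.eq_zero_or_pos n with h | h
    · simp [h]
    · exact (div_le_one (by exact_mod_cast h)).2 (by exact_mod_cast h)
  calc ‖(1 / (n : ℝ))‖ * ‖W.carrier t (n • x)‖ ≤ 1 * (k / (2 * Real.pi)) :=
        mul_le_mul h1 (norm_carrier_nsmul_le W t n x) (norm_nonneg _) zero_le_one
    _ = k / (2 * Real.pi) := one_mul _

/-- The space–time lift of the cell carrier is in `L^∞((0,T) × T³)`. [folklore] -/
theorem memLp_top_stLift_cell (W : LatticeWord k) (n : ℕ) (T : ℝ) :
    MemLp (stLift (W.cell n)) ∞ (volume.restrict (Ioo 0 T ×ˢ (univ : Set (EuclideanSpace ℝ (Fin 3))))) := by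
  have hc : Continuous (stLift (W.cell n)) := by
    have e : stLift (W.cell n) = uncurry (W.cell n) ∘ Prod.map id proj := by
      funext ⟨t, y⟩
      rfl
    rw [e]
    exact (continuous_uncurry_cell W n).comp (continuous_id.prodMap continuous_proj)
  exact memLp_top_of_bound hc.aestronglyMeasurable (k / (2 * Real.pi))
    (ae_of_all _ fun p => norm_cell_le W n p.1 (proj p.2))

/-- **Registered stub `stub_cellUnique` of crux K2R `RealisedQuasiStaticCellLaw` (line `floquet-bloch`)**: A0 weak
solutions around the cells of any lattice word are unique in the weak class `L^∞_t L²_x` — for every lattice word `W'`,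
cell number `n`, viscosity `κ > 0`, horizon `T` and datum `w₀`, two weak solutions of the passive solenoidal vector equation
(`A = 0`) around `W'.cell n` coincide for a.e. `t ∈ (0,T)` (bounded jointly continuous carrier, so
`IsWeakPassiveVectorOn.ae_eq_of_memLp_top` applies). [cite: Evans2010, §7.1.2 Thm. 2] -/
theorem stub_cellUnique : ∀ (k : ℕ) (W' : LatticeWord k) (n : ℕ) (κ T : ℝ), 0 < κ →
    ∀ w₀ : UnitAddTorus (Fin 3) → EuclideanSpace ℝ (Fin 3),
    ∀ w₁ w₂ : ℝ → UnitAddTorus (Fin 3) → EuclideanSpace ℝ (Fin 3),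
    Torus.IsWeakPassiveVectorOn 0 T κ (W'.cell n) w₀ w₁ →
    Torus.IsWeakPassiveVectorOn 0 T κ (W'.cell n) w₀ w₂ →
    ∀ᵐ t ∂(volume.restrict (Ioo 0 T)), w₁ t =ᵐ[volume] w₂ t := by
  intro k W' n κ T hκ w₀ w₁ w₂ h₁ h₂
  exact Torus.IsWeakPassiveVectorOn.ae_eq_of_memLp_top hκ h₁ h₂ (memLp_top_stLift_cell W' n T)

end Summit.AnomalousDissipation.AnomalousDissipation.Theorems.SolenoidalFractalHomogenisation.RealisedQuasiStaticCellLaw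

end
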